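import Mathlib.Analysis.Normed.Module.Connected
import Mathlib.Topology.Order.Compact
import Literature.Analysis.PDE.HopfMinimumPrinciple
import Literature.Analysis.FluidPDE.SverakLandauTransfer
import HarnessLib

/-!
# Šverák's classification of `(−1)`-homogeneous steady Navier–Stokes flows — Lemma 1

Analysis/FluidPDE support file, seventh of the series `SverakLandau*` proving the named fact
`Literature.Analysis.FluidPDE.Sverak2011_landauClassification` (V. Šverák, J. Math. Sci. 179
(2011) = arXiv:math/0604550, Thm. 1).

**Šverák 2011, §4, Lemma 1** ("`ω ≡ 0`": the radial vorticity of a smooth `(−1)`-homogeneous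
steady Navier–Stokes flow in `ℝ³ ∖ {0}` vanishes) **and the Bernoulli relation**
"`½|v|² + p − f = c`" that follows it in print — here obtained together and in the opposite
order: by the previous files the `0`-homogeneous Bernoulli function
`K = |x|²(½|u|² + P₂) − ½F² − F` (`= ½|v|² + p − f` on the sphere) satisfies
`ΔK − u·∇K = ⟪x, curl u⟫² ≥ 0` on the connected open set `Ω = ℝ³ ∖ {0}` and attains its maximum
(on the unit sphere, by homogeneity); E. Hopf's strong maximum principle (tree:
`Literature.Analysis.PDE.hopf_minimumPrinciple`, López-Gómez 2012, Thm. 1.2, applied to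
`M − 1 − K` with `a = I`, `b = u`, `c = 0`) makes `K` constant, whence `⟪x, curl u⟫ ≡ 0`.
In print Lemma 1 is proved by a Fredholm-alternative argument for `−Δω + div(vω) = 0` on `S²`
(Šverák's Remark: "I assume the above argument is known in one form or another"); the present
route only uses the maximum principle.

* `Sverak2011.fderiv_fderiv_apply_eq_pderiv` — `D²K(x)(eᵢ)(eⱼ) = ∂ᵢ∂ⱼK(x)` (bridge to the
  coordinate form of the tree's minimum principle);
* `Sverak2011.bernoulliK_const_and_radVort_eq_zero` — **`K ≡ k₀` and `⟪x, curl u x⟫ = 0` on `Ω`**,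
  with the pressure-free radial-profile equation
  `|x|²(−∑ₗ∂ₗ∂ₗF + ∑ₗ uₗ∂ₗF) = F² + 2F + 2k₀` (Šverák's (E2) before integration).

## References

* V. Šverák, *On Landau's solutions of the Navier–Stokes equations*, J. Math. Sci. 179 (2011)
  208–228, arXiv:math/0604550, §4, Lemma 1 and the display after its proof. [`Sverak2011`]
* J. López-Gómez, *Linear Second Order Elliptic Operators*, World Scientific (2013), Thm. 1.2.
  [`LopezGomez2012`]
-/

noncomputable section

open Set Filter Metric
open scoped Topology BigOperators ContDiff Laplacian RealInnerProductSpace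

namespace Literature.Analysis.FluidPDE

namespace Sverak2011

/-- **Second Fréchet derivative versus second partials**: for `f` twice differentiable near `x`
(precisely: `Df` differentiable at `x`), `D(Df)(x)(eᵢ)(eⱼ) = ∂ᵢ∂ⱼf(x)`. [folklore] -/
theorem fderiv_fderiv_apply_eq_pderiv {ι : Type*} [Fintype ι] [DecidableEq ι]
    {f : EuclideanSpace ℝ ι → ℝ} {x : EuclideanSpace ℝ ι}
    (hd : DifferentiableAt ℝ (fderiv ℝ f) x) (i j : ι) :
    fderiv ℝ (fderiv ℝ f) x (EuclideanSpace.single i 1) (EuclideanSpace.single j 1) =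
      pderiv i (pderiv j f) x := by
  rw [pderiv_apply, pderiv_eq j, fderiv_clm_apply hd (differentiableAt_const _)]
  simp [fderiv_fun_const, stdVec]

/-- `ℝ³ ∖ {0}` is preconnected. [folklore] -/
theorem isPreconnected_compl_zero : IsPreconnected {x : EuclideanSpace ℝ (Fin 3) | x ≠ 0} := by
  have h : {x : EuclideanSpace ℝ (Fin 3) | x ≠ 0} = {(0 : EuclideanSpace ℝ (Fin 3))}ᶜ := by
    ext v; simp
  rw [h]
  refine (isConnected_compl_singleton_of_one_lt_rank ?_ 0).isPreconnected
  rw [← Module.finrank_eq_rank, finrank_euclideanSpace_fin]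
  norm_num

variable {u : EuclideanSpace ℝ (Fin 3) → EuclideanSpace ℝ (Fin 3)} {p : EuclideanSpace ℝ (Fin 3) → ℝ}
  {F P₂ K : EuclideanSpace ℝ (Fin 3) → ℝ}

/-- **Šverák 2011, Lemma 1, with the Bernoulli relation** (§4).  For a smooth solution `(u, p)`
of the steady Navier–Stokes equations in `ℝ³ ∖ {0}` with `t u(t x) = u(x)` (`t > 0`), and
`F = ⟪x, u⟫`, `P₂ = −½∑ⱼ xⱼ∂ⱼp`, `K = |x|²(½|u|² + P₂) − ½F² − F`: (i) `K` is constant on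
`{x ≠ 0}` ("`½|v|² + p − f = c`"); (ii) the radial vorticity vanishes, `⟪x, curl u(x)⟫ = 0`
("`ω ≡ 0`", Lemma 1); (iii) the radial profile satisfies the pressure-free equation
`|x|²(−∑ₗ∂ₗ∂ₗF + ∑ₗ uₗ∂ₗF) = F² + 2F + 2k₀` (Šverák's (E2) `−Δf − 2f + div(fv) = 2c` in bulk
form).  Proof: strong maximum principle for `ΔK − u·∇K = ⟪x, curl u⟫² ≥ 0`, `K` being
`0`-homogeneous. [cite: Sverak2011, §4 Lemma 1] -/
theorem bernoulliK_const_and_radVort_eq_zero (hu : ContDiffOn ℝ ∞ u {x | x ≠ 0})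
    (hp : ContDiffOn ℝ ∞ p {x | x ≠ 0})
    (hns : ∀ x, x ≠ 0 → -(Δ u) x + convect u u x + gradient p x = 0)
    (hdiv : ∀ x, x ≠ 0 → VectorCalculus.divergence u x = 0)
    (hhom : ∀ (t : ℝ) (x : EuclideanSpace ℝ (Fin 3)), 0 < t → x ≠ 0 → t • u (t • x) = u x)
    (hF : F = fun x => ∑ i, x i * u x i) (hP₂ : P₂ = fun x => -(2⁻¹ * ∑ j, x j * pderiv j p x))
    (hK : K = fun x => (∑ i, x i ^ 2) * (2⁻¹ * ∑ i, u x i ^ 2 + P₂ x) - 2⁻¹ * F x ^ 2 - F x) :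
    ∃ k₀ : ℝ, (∀ x, x ≠ 0 → K x = k₀) ∧ (∀ x, x ≠ 0 → ⟪x, curl u x⟫ = 0) ∧
      ∀ x, x ≠ 0 → (∑ i, x i ^ 2) * (-∑ l, pderiv l (pderiv l F) x + ∑ l, u x l * pderiv l F x) =
        F x ^ 2 + 2 * F x + 2 * k₀ := by
  have hid := fun x (hx : x ≠ 0) => bernoulliK_identity hu hp hns hdiv hhom hF hP₂ hK hx
  obtain ⟨hKs, -, -⟩ := contDiffOn_bernoulliK hu hp hns hdiv hhom hF hP₂ hK
  have hΩ : IsOpen {x : EuclideanSpace ℝ (Fin 3) | x ≠ 0} := isOpen_compl_singleton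
  -- `K` attains its maximum `M` on `Ω`, at a point `x₁` of the unit sphere
  have hsph : sphere (0 : EuclideanSpace ℝ (Fin 3)) 1 ⊆ {x | x ≠ 0} := fun y hy => by
    have : ‖y‖ = 1 := by simpa using hy
    exact norm_ne_zero_iff.mp (by rw [this]; exact one_ne_zero)
  obtain ⟨x₁, hx₁s, hmax⟩ := (isCompact_sphere (0 : EuclideanSpace ℝ (Fin 3)) 1).exists_isMaxOn
    ⟨EuclideanSpace.single 0 1, by simp⟩ (hKs.continuousOn.mono hsph)
  have hx₁ : x₁ ≠ 0 := hsph hx₁s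
  set M : ℝ := K x₁ with hM
  have hle : ∀ x : EuclideanSpace ℝ (Fin 3), x ≠ 0 → K x ≤ M := by
    intro x hx
    have hr : 0 < ‖x‖ := norm_pos_iff.mpr hx
    have h1 : K (‖x‖⁻¹ • x) = K x := bernoulliK_smul hu hp hns hdiv hhom hF hP₂ hK (inv_pos.mpr hr) hx
    have h2 : ‖x‖⁻¹ • x ∈ sphere (0 : EuclideanSpace ℝ (Fin 3)) 1 := by
      rw [mem_sphere_zero_iff_norm, norm_smul, norm_inv, norm_norm, inv_mul_cancel₀ hr.ne']
    rw [← h1]; exact hmax h2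
  -- E. Hopf's strong maximum principle for `G = M − 1 − K`
  set G : EuclideanSpace ℝ (Fin 3) → ℝ := fun x => M - 1 - K x with hG
  have hGs : ContDiffOn ℝ 2 G {x | x ≠ 0} :=
    (contDiffOn_const.sub (hKs.of_le (by norm_cast))).congr (fun x _ => by rw [hG])
  have hfG : ∀ x, fderiv ℝ G x = -fderiv ℝ K x := fun x => by
    rw [hG]; exact fderiv_const_sub _
  have hffG : ∀ x, fderiv ℝ (fderiv ℝ G) x = -fderiv ℝ (fderiv ℝ K) x := fun x => by
    rw [show fderiv ℝ G = fun y => -fderiv ℝ K y from funext hfG]; exact fderiv_neg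
  have hconst : ∀ x ∈ {x : EuclideanSpace ℝ (Fin 3) | x ≠ 0}, G x = -1 := by
    refine Literature.Analysis.PDE.hopf_minimumPrinciple (N := 3) hΩ isPreconnected_compl_zero
      (a := fun _ i j => if i = j then 1 else 0) (b := fun x i => u x i) (c := fun _ => 0)
      (μ := 1) (m := -1) (fun _ _ i j => by simp [eq_comm]) one_pos ?_ ?_ (fun _ _ => le_rfl)
      hGs ?_ (by norm_num) (fun x hx => by rw [hG]; linarith [hle x hx]) hx₁ (by rw [hG]; ring)
    · -- ellipticity of the identity matrix
      intro x _ ξ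
      rw [one_mul, EuclideanSpace.real_norm_sq_eq]
      refine le_of_eq (Finset.sum_congr rfl fun i _ => ?_)
      simp only [ite_mul, one_mul, zero_mul, Finset.sum_ite_eq, Finset.mem_univ, if_true]
      ring
    · -- local boundedness of the coefficients
      intro K' hK' hK'c
      obtain ⟨B, hB⟩ := hK'c.exists_bound_of_continuousOn (hu.continuousOn.mono hK')
      refine ⟨max 1 B, fun x hx => ⟨fun i j => ?_, fun i => ?_, by simp⟩⟩
      · split_ifs <;> simp
      · exact ((Real.norm_eq_abs _).symm.le.trans ((PiLp.norm_apply_le (u x) i).trans (hB x hx))).trans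
          (le_max_right _ _)
    · -- `𝔏G = ΔK − u·∇K = ⟪x, curl u⟫² ≥ 0`
      intro x hx
      have hKx : ContDiffAt ℝ ∞ K x := (hid x hx).2.2.2.1
      have hdK : DifferentiableAt ℝ (fderiv ℝ K) x :=
        (hKx.fderiv_right (m := 1) (by norm_cast)).differentiableAt one_ne_zero
      simp only [hffG, hfG, FunLike.coe_neg, Pi.neg_apply, fderiv_fderiv_apply_eq_pderiv hdK,
        zero_mul, add_zero, ite_mul, one_mul, zero_mul, Finset.sum_ite_eq, Finset.mem_univ,
        if_true, mul_neg, Finset.sum_neg_distrib, neg_neg]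
      have h1 := (hid x hx).1
      have e : ∀ i, fderiv ℝ K x (EuclideanSpace.single i 1) = pderiv i K x := fun i => rfl
      simp only [e]
      nlinarith [h1, sq_nonneg (x 0 * (pderiv 1 (fun z => u z 2) x - pderiv 2 (fun z => u z 1) x) +
        x 1 * (pderiv 2 (fun z => u z 0) x - pderiv 0 (fun z => u z 2) x) +
        x 2 * (pderiv 0 (fun z => u z 1) x - pderiv 1 (fun z => u z 0) x))]
  -- conclusions
  have hKM : ∀ x : EuclideanSpace ℝ (Fin 3), x ≠ 0 → K x = M := fun x hx => by
    have := hconst x hx; rw [hG] at this; linarith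
  refine ⟨M, hKM, fun x hx => ?_, fun x hx => ?_⟩
  · -- the partials of the constant `K` vanish, so `⟪x, curl u⟫² = 0`
    have hEq : EqOn K (fun _ => M) {x | x ≠ 0} := fun y hy => hKM y hy
    have h1 := (hid x hx).1
    simp only [pderiv_pderiv_eqOn hΩ hEq _ _ hx, pderiv_eqOn hΩ hEq _ hx, pderiv_const,
      mul_zero, Finset.sum_const_zero, sub_zero] at h1
    have hd : DifferentiableAt ℝ u x :=
      (hu.contDiffAt (hΩ.mem_nhds hx)).differentiableAt (by simp)
    rw [inner_curl_eq hd]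
    exact pow_eq_zero_iff (n := 2) (by norm_num) |>.mp h1.symm
  · have h2 := (hid x hx).2.1
    have h3 : K x = M := hKM x hx
    rw [hK] at h3
    have h4 : (∑ i, x i ^ 2) * (∑ i, u x i ^ 2 + 2 * P₂ x) = F x ^ 2 + 2 * F x + 2 * M := by
      linarith
    rw [h2, h4]

end Sverak2011

end Literature.Analysis.FluidPDE
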